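import Summits.CriticalPhenomena.PercolationContinuityZ3.Theorems.PercNearOneGluingNoHeavyLowerTailFrontierDecRowsLeFive
import Mathlib.Tactic.Ring
import Mathlib.Tactic.Linarith
import HarnessLib

/-!
# The four-point dec cubic frontier and the MONOTONE POLARIZATION hypothesis: rows 15, 36 (PATH), 37, 44 are its diagonal

Support file (prover prim-l12-p6 gen 17; `--supports stmt-CriticalPhenomena-4575`).  No definitions, no named facts, no sorries, no `native_decide`.
Everything about the rows is CONDITIONAL on the hypothesis `hMP` below (written out in each theorem; it is NOT a tree fact and NOT claimed): the file records,
in the kernel, the exact statement of the conjecture, that each open row is its diagonal, and the pointwise lemma behind it.  Memo: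
`run/shared/lean/prim/prim-l12/FROM-prim-l12-p6-g17-MONOTONE-POLARIZATION.md` (exact census: kit j157295 / j157440, 0 negatives in > 10⁶ instances of ordered
triples incl. n ≤ 9; 4–11 % negatives for triples ordered only at the top).

THE POLARIZED SAHI FORM.  For three finite measures `μ₁ μ₂ μ₃` on one space and events `A B C`,
  `6·T(μ₁,μ₂,μ₃) = Σ_{σ ∈ S₃} F(μ_{σ1},μ_{σ2},μ_{σ3})`,  `F(μ,ν,λ) = 2μ(ABC) + μ(A)ν(B)λ(C) − μ(A)ν(BC) − μ(B)ν(AC) − μ(C)ν(AB)`,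
the symmetric trilinear polarization of Sahi's `E₃` (`Literature.Probability.LatticeModels.sahiE3`): `Σ_σ F(μ,μ,μ) = 6·E₃(μ)` (`six_mul_sahiE3_eq_polar`).
MONOTONE POLARIZATION (conjecture, prim-l12-p6 g17): for a row `(A,B,C)` of terminal-separation events on `Fin n` and three edge-weight functions ordered pointwise,
`w₃ ≤ w₂ ≤ w₁`, `0 ≤ T(prodBernoulli w₁, prodBernoulli w₂, prodBernoulli w₃)`.  Its diagonal `w₁ = w₂ = w₃` is the row; the two-level single-edge case is the
nonnegativity of the two mixed Bernstein coefficients of an edge pencil (cp-hms census); same-law switching certificates do not apply off the diagonal.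
POINTWISE CHAIN LEMMA (`polar_chain_toNat_le`, `polar_bits_chain_nonneg`): for three NESTED triples of indicator values (the values of `1_A, 1_B, 1_C` at a chain of
configurations `ω₁ ≥ ω₂ ≥ ω₃` of three decreasing events), the polarized form of the three point masses is `≥ 0` — all 64 cases (141 of the 512 unrestricted bit triples
are negative): the independent coupling of three ordered laws is the content of the conjecture, the monotone coupling is free.

* `six_mul_sahiE3_eq_polar` — the diagonal identity (pure algebra, any measure);
* `polar_chain_toNat_le` (Booleans, `decide`) and `polar_bits_chain_nonneg` (reals) — the pointwise chain lemma;
* `frontier_15_all_of_monotonePolarization`, `frontier_36_…`, `frontier_37_…`, `frontier_44_…` — each open row from the hypothesis for that row (same `n`).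
-/

noncomputable section

namespace Summit.CriticalPhenomena.PercolationContinuityZ3.Theorems.FrontierDecRows

open MeasureTheory CovTransferCert E3GroupSepCert
open Literature.Probability.Percolation Literature.Probability.LatticeModels

/-! ### The diagonal identity -/

/-- **`Σ_σ F(μ,μ,μ) = 6·E₃(μ)`**: on the diagonal the polarized form is six times Sahi's `E₃`. [this work] -/
theorem six_mul_sahiE3_eq_polar {Ω : Type*} [MeasurableSpace Ω] (μ : Measure Ω) (A B C : Set Ω) :
    6 * sahiE3 μ A B C =
      (2 * μ.real (A ∩ B ∩ C) + μ.real A * μ.real B * μ.real C - μ.real A * μ.real (B ∩ C) - μ.real B * μ.real (A ∩ C) - μ.real C * μ.real (A ∩ B)) +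
        (2 * μ.real (A ∩ B ∩ C) + μ.real A * μ.real B * μ.real C - μ.real A * μ.real (B ∩ C) - μ.real B * μ.real (A ∩ C) - μ.real C * μ.real (A ∩ B)) +
        (2 * μ.real (A ∩ B ∩ C) + μ.real A * μ.real B * μ.real C - μ.real A * μ.real (B ∩ C) - μ.real B * μ.real (A ∩ C) - μ.real C * μ.real (A ∩ B)) +
        (2 * μ.real (A ∩ B ∩ C) + μ.real A * μ.real B * μ.real C - μ.real A * μ.real (B ∩ C) - μ.real B * μ.real (A ∩ C) - μ.real C * μ.real (A ∩ B)) +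
        (2 * μ.real (A ∩ B ∩ C) + μ.real A * μ.real B * μ.real C - μ.real A * μ.real (B ∩ C) - μ.real B * μ.real (A ∩ C) - μ.real C * μ.real (A ∩ B)) +
        (2 * μ.real (A ∩ B ∩ C) + μ.real A * μ.real B * μ.real C - μ.real A * μ.real (B ∩ C) - μ.real B * μ.real (A ∩ C) - μ.real C * μ.real (A ∩ B)) := by
  rw [sahiE3_def]
  ring

/-! ### The pointwise chain lemma -/

/-- **Pointwise chain lemma (Boolean form)**: for nested bits `a₁ ≤ a₂ ≤ a₃`, `b₁ ≤ b₂ ≤ b₃`, `c₁ ≤ c₂ ≤ c₃` (the indicators of three monotone events at a chain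
of three configurations), the negative part of the polarized form of the three point masses is dominated by its positive part (all 64 cases). [this work] -/
theorem polar_chain_toNat_le :
    ∀ a₁ a₂ a₃ b₁ b₂ b₃ c₁ c₂ c₃ : Bool,
      a₁ ≤ a₂ → a₂ ≤ a₃ → b₁ ≤ b₂ → b₂ ≤ b₃ → c₁ ≤ c₂ → c₂ ≤ c₃ →
      (a₁.toNat * (b₂.toNat * c₂.toNat) + b₁.toNat * (a₂.toNat * c₂.toNat) + c₁.toNat * (a₂.toNat * b₂.toNat)) +
        (a₁.toNat * (b₃.toNat * c₃.toNat) + b₁.toNat * (a₃.toNat * c₃.toNat) + c₁.toNat * (a₃.toNat * b₃.toNat)) +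
        (a₂.toNat * (b₁.toNat * c₁.toNat) + b₂.toNat * (a₁.toNat * c₁.toNat) + c₂.toNat * (a₁.toNat * b₁.toNat)) +
        (a₂.toNat * (b₃.toNat * c₃.toNat) + b₂.toNat * (a₃.toNat * c₃.toNat) + c₂.toNat * (a₃.toNat * b₃.toNat)) +
        (a₃.toNat * (b₁.toNat * c₁.toNat) + b₃.toNat * (a₁.toNat * c₁.toNat) + c₃.toNat * (a₁.toNat * b₁.toNat)) +
        (a₃.toNat * (b₂.toNat * c₂.toNat) + b₃.toNat * (a₂.toNat * c₂.toNat) + c₃.toNat * (a₂.toNat * b₂.toNat)) ≤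
      (2 * a₁.toNat * b₁.toNat * c₁.toNat + a₁.toNat * b₂.toNat * c₃.toNat) +
        (2 * a₁.toNat * b₁.toNat * c₁.toNat + a₁.toNat * b₃.toNat * c₂.toNat) +
        (2 * a₂.toNat * b₂.toNat * c₂.toNat + a₂.toNat * b₁.toNat * c₃.toNat) +
        (2 * a₂.toNat * b₂.toNat * c₂.toNat + a₂.toNat * b₃.toNat * c₁.toNat) +
        (2 * a₃.toNat * b₃.toNat * c₃.toNat + a₃.toNat * b₁.toNat * c₂.toNat) +
        (2 * a₃.toNat * b₃.toNat * c₃.toNat + a₃.toNat * b₂.toNat * c₁.toNat) := by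
  decide

/-- **Pointwise chain lemma, real form**: for nested `{0,1}`-valued triples the polarized cubic of the three point masses is nonnegative. [this work] -/
theorem polar_bits_chain_nonneg (a₁ a₂ a₃ b₁ b₂ b₃ c₁ c₂ c₃ : ℝ)
    (ha : (a₁, a₂, a₃) ∈ ({((0:ℝ), (0:ℝ), (0:ℝ)), (0, 0, 1), (0, 1, 1), (1, 1, 1)} : Set (ℝ × ℝ × ℝ)))
    (hb : (b₁, b₂, b₃) ∈ ({((0:ℝ), (0:ℝ), (0:ℝ)), (0, 0, 1), (0, 1, 1), (1, 1, 1)} : Set (ℝ × ℝ × ℝ)))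
    (hc : (c₁, c₂, c₃) ∈ ({((0:ℝ), (0:ℝ), (0:ℝ)), (0, 0, 1), (0, 1, 1), (1, 1, 1)} : Set (ℝ × ℝ × ℝ))) :
    0 ≤ (2 * a₁ * b₁ * c₁ + a₁ * b₂ * c₃ - a₁ * (b₂ * c₂) - b₁ * (a₂ * c₂) - c₁ * (a₂ * b₂)) +
        (2 * a₁ * b₁ * c₁ + a₁ * b₃ * c₂ - a₁ * (b₃ * c₃) - b₁ * (a₃ * c₃) - c₁ * (a₃ * b₃)) +
        (2 * a₂ * b₂ * c₂ + a₂ * b₁ * c₃ - a₂ * (b₁ * c₁) - b₂ * (a₁ * c₁) - c₂ * (a₁ * b₁)) +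
        (2 * a₂ * b₂ * c₂ + a₂ * b₃ * c₁ - a₂ * (b₃ * c₃) - b₂ * (a₃ * c₃) - c₂ * (a₃ * b₃)) +
        (2 * a₃ * b₃ * c₃ + a₃ * b₁ * c₂ - a₃ * (b₁ * c₁) - b₃ * (a₁ * c₁) - c₃ * (a₁ * b₁)) +
        (2 * a₃ * b₃ * c₃ + a₃ * b₂ * c₁ - a₃ * (b₂ * c₂) - b₃ * (a₂ * c₂) - c₃ * (a₂ * b₂)) := by
  simp only [Set.mem_insert_iff, Set.mem_singleton_iff, Prod.mk.injEq] at ha hb hc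
  rcases ha with ⟨rfl, rfl, rfl⟩ | ⟨rfl, rfl, rfl⟩ | ⟨rfl, rfl, rfl⟩ | ⟨rfl, rfl, rfl⟩ <;>
    rcases hb with ⟨rfl, rfl, rfl⟩ | ⟨rfl, rfl, rfl⟩ | ⟨rfl, rfl, rfl⟩ | ⟨rfl, rfl, rfl⟩ <;>
    rcases hc with ⟨rfl, rfl, rfl⟩ | ⟨rfl, rfl, rfl⟩ | ⟨rfl, rfl, rfl⟩ | ⟨rfl, rfl, rfl⟩ <;>
    norm_num

/-! ### The four open rows are the diagonal of the hypothesis -/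

variable {n : ℕ}

/-- **Row 15 `(D[ab|c], D[ac|y], D[b|y])` on every finite weighted graph from MONOTONE POLARIZATION for row 15** (hypothesis `hMP`, written out: the polarized
Sahi form of the row's three events is nonnegative at every pointwise-ordered triple of edge weights `w₃ ≤ w₂ ≤ w₁` on `Fin n`). [this work] -/
theorem frontier_15_all_of_monotonePolarization
    (hMP : ∀ (w₁ w₂ w₃ : Sym2 (Fin n) → unitInterval) (a b c y : Fin n), (∀ e, w₃ e ≤ w₂ e) → (∀ e, w₂ e ≤ w₁ e) →
      ∀ A B C : Set (BondConfig (Fin n)), A = connEvent (row 15 n (a, b, c, y)).1 → B = connEvent (row 15 n (a, b, c, y)).2.1 →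
      C = connEvent (row 15 n (a, b, c, y)).2.2 →
      0 ≤ (2 * (prodBernoulli w₁).real (A ∩ B ∩ C) + (prodBernoulli w₁).real A * (prodBernoulli w₂).real B * (prodBernoulli w₃).real C - (prodBernoulli w₁).real A * (prodBernoulli w₂).real (B ∩ C) - (prodBernoulli w₁).real B * (prodBernoulli w₂).real (A ∩ C) - (prodBernoulli w₁).real C * (prodBernoulli w₂).real (A ∩ B)) +
        (2 * (prodBernoulli w₁).real (A ∩ B ∩ C) + (prodBernoulli w₁).real A * (prodBernoulli w₃).real B * (prodBernoulli w₂).real C - (prodBernoulli w₁).real A * (prodBernoulli w₃).real (B ∩ C) - (prodBernoulli w₁).real B * (prodBernoulli w₃).real (A ∩ C) - (prodBernoulli w₁).real C * (prodBernoulli w₃).real (A ∩ B)) +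
        (2 * (prodBernoulli w₂).real (A ∩ B ∩ C) + (prodBernoulli w₂).real A * (prodBernoulli w₁).real B * (prodBernoulli w₃).real C - (prodBernoulli w₂).real A * (prodBernoulli w₁).real (B ∩ C) - (prodBernoulli w₂).real B * (prodBernoulli w₁).real (A ∩ C) - (prodBernoulli w₂).real C * (prodBernoulli w₁).real (A ∩ B)) +
        (2 * (prodBernoulli w₂).real (A ∩ B ∩ C) + (prodBernoulli w₂).real A * (prodBernoulli w₃).real B * (prodBernoulli w₁).real C - (prodBernoulli w₂).real A * (prodBernoulli w₃).real (B ∩ C) - (prodBernoulli w₂).real B * (prodBernoulli w₃).real (A ∩ C) - (prodBernoulli w₂).real C * (prodBernoulli w₃).real (A ∩ B)) +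
        (2 * (prodBernoulli w₃).real (A ∩ B ∩ C) + (prodBernoulli w₃).real A * (prodBernoulli w₁).real B * (prodBernoulli w₂).real C - (prodBernoulli w₃).real A * (prodBernoulli w₁).real (B ∩ C) - (prodBernoulli w₃).real B * (prodBernoulli w₁).real (A ∩ C) - (prodBernoulli w₃).real C * (prodBernoulli w₁).real (A ∩ B)) +
        (2 * (prodBernoulli w₃).real (A ∩ B ∩ C) + (prodBernoulli w₃).real A * (prodBernoulli w₂).real B * (prodBernoulli w₁).real C - (prodBernoulli w₃).real A * (prodBernoulli w₂).real (B ∩ C) - (prodBernoulli w₃).real B * (prodBernoulli w₂).real (A ∩ C) - (prodBernoulli w₃).real C * (prodBernoulli w₂).real (A ∩ B)))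
    (w : Sym2 (Fin n) → unitInterval) (a b c y : Fin n) :
    0 ≤ sahiE3 (prodBernoulli w) (connEvent (row 15 n (a, b, c, y)).1) (connEvent (row 15 n (a, b, c, y)).2.1)
      (connEvent (row 15 n (a, b, c, y)).2.2) := by
  have h := hMP w w w a b c y (fun _ => le_rfl) (fun _ => le_rfl) _ _ _ rfl rfl rfl
  have h6 := six_mul_sahiE3_eq_polar (prodBernoulli w) (connEvent (row 15 n (a, b, c, y)).1) (connEvent (row 15 n (a, b, c, y)).2.1)
    (connEvent (row 15 n (a, b, c, y)).2.2)
  linarith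

/-- **Row 36 `(D[a|b], D[a|c], D[b|y] (PATH))` on every finite weighted graph from MONOTONE POLARIZATION for row 36** (hypothesis `hMP`, written out: the polarized
Sahi form of the row's three events is nonnegative at every pointwise-ordered triple of edge weights `w₃ ≤ w₂ ≤ w₁` on `Fin n`). [this work] -/
theorem frontier_36_all_of_monotonePolarization
    (hMP : ∀ (w₁ w₂ w₃ : Sym2 (Fin n) → unitInterval) (a b c y : Fin n), (∀ e, w₃ e ≤ w₂ e) → (∀ e, w₂ e ≤ w₁ e) →
      ∀ A B C : Set (BondConfig (Fin n)), A = connEvent (row 36 n (a, b, c, y)).1 → B = connEvent (row 36 n (a, b, c, y)).2.1 →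
      C = connEvent (row 36 n (a, b, c, y)).2.2 →
      0 ≤ (2 * (prodBernoulli w₁).real (A ∩ B ∩ C) + (prodBernoulli w₁).real A * (prodBernoulli w₂).real B * (prodBernoulli w₃).real C - (prodBernoulli w₁).real A * (prodBernoulli w₂).real (B ∩ C) - (prodBernoulli w₁).real B * (prodBernoulli w₂).real (A ∩ C) - (prodBernoulli w₁).real C * (prodBernoulli w₂).real (A ∩ B)) +
        (2 * (prodBernoulli w₁).real (A ∩ B ∩ C) + (prodBernoulli w₁).real A * (prodBernoulli w₃).real B * (prodBernoulli w₂).real C - (prodBernoulli w₁).real A * (prodBernoulli w₃).real (B ∩ C) - (prodBernoulli w₁).real B * (prodBernoulli w₃).real (A ∩ C) - (prodBernoulli w₁).real C * (prodBernoulli w₃).real (A ∩ B)) +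
        (2 * (prodBernoulli w₂).real (A ∩ B ∩ C) + (prodBernoulli w₂).real A * (prodBernoulli w₁).real B * (prodBernoulli w₃).real C - (prodBernoulli w₂).real A * (prodBernoulli w₁).real (B ∩ C) - (prodBernoulli w₂).real B * (prodBernoulli w₁).real (A ∩ C) - (prodBernoulli w₂).real C * (prodBernoulli w₁).real (A ∩ B)) +
        (2 * (prodBernoulli w₂).real (A ∩ B ∩ C) + (prodBernoulli w₂).real A * (prodBernoulli w₃).real B * (prodBernoulli w₁).real C - (prodBernoulli w₂).real A * (prodBernoulli w₃).real (B ∩ C) - (prodBernoulli w₂).real B * (prodBernoulli w₃).real (A ∩ C) - (prodBernoulli w₂).real C * (prodBernoulli w₃).real (A ∩ B)) +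
        (2 * (prodBernoulli w₃).real (A ∩ B ∩ C) + (prodBernoulli w₃).real A * (prodBernoulli w₁).real B * (prodBernoulli w₂).real C - (prodBernoulli w₃).real A * (prodBernoulli w₁).real (B ∩ C) - (prodBernoulli w₃).real B * (prodBernoulli w₁).real (A ∩ C) - (prodBernoulli w₃).real C * (prodBernoulli w₁).real (A ∩ B)) +
        (2 * (prodBernoulli w₃).real (A ∩ B ∩ C) + (prodBernoulli w₃).real A * (prodBernoulli w₂).real B * (prodBernoulli w₁).real C - (prodBernoulli w₃).real A * (prodBernoulli w₂).real (B ∩ C) - (prodBernoulli w₃).real B * (prodBernoulli w₂).real (A ∩ C) - (prodBernoulli w₃).real C * (prodBernoulli w₂).real (A ∩ B)))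
    (w : Sym2 (Fin n) → unitInterval) (a b c y : Fin n) :
    0 ≤ sahiE3 (prodBernoulli w) (connEvent (row 36 n (a, b, c, y)).1) (connEvent (row 36 n (a, b, c, y)).2.1)
      (connEvent (row 36 n (a, b, c, y)).2.2) := by
  have h := hMP w w w a b c y (fun _ => le_rfl) (fun _ => le_rfl) _ _ _ rfl rfl rfl
  have h6 := six_mul_sahiE3_eq_polar (prodBernoulli w) (connEvent (row 36 n (a, b, c, y)).1) (connEvent (row 36 n (a, b, c, y)).2.1)
    (connEvent (row 36 n (a, b, c, y)).2.2)
  linarith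

/-- **Row 37 `(D[ab|c], D[ac|y], D[ay|b])` on every finite weighted graph from MONOTONE POLARIZATION for row 37** (hypothesis `hMP`, written out: the polarized
Sahi form of the row's three events is nonnegative at every pointwise-ordered triple of edge weights `w₃ ≤ w₂ ≤ w₁` on `Fin n`). [this work] -/
theorem frontier_37_all_of_monotonePolarization
    (hMP : ∀ (w₁ w₂ w₃ : Sym2 (Fin n) → unitInterval) (a b c y : Fin n), (∀ e, w₃ e ≤ w₂ e) → (∀ e, w₂ e ≤ w₁ e) →
      ∀ A B C : Set (BondConfig (Fin n)), A = connEvent (row 37 n (a, b, c, y)).1 → B = connEvent (row 37 n (a, b, c, y)).2.1 →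
      C = connEvent (row 37 n (a, b, c, y)).2.2 →
      0 ≤ (2 * (prodBernoulli w₁).real (A ∩ B ∩ C) + (prodBernoulli w₁).real A * (prodBernoulli w₂).real B * (prodBernoulli w₃).real C - (prodBernoulli w₁).real A * (prodBernoulli w₂).real (B ∩ C) - (prodBernoulli w₁).real B * (prodBernoulli w₂).real (A ∩ C) - (prodBernoulli w₁).real C * (prodBernoulli w₂).real (A ∩ B)) +
        (2 * (prodBernoulli w₁).real (A ∩ B ∩ C) + (prodBernoulli w₁).real A * (prodBernoulli w₃).real B * (prodBernoulli w₂).real C - (prodBernoulli w₁).real A * (prodBernoulli w₃).real (B ∩ C) - (prodBernoulli w₁).real B * (prodBernoulli w₃).real (A ∩ C) - (prodBernoulli w₁).real C * (prodBernoulli w₃).real (A ∩ B)) +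
        (2 * (prodBernoulli w₂).real (A ∩ B ∩ C) + (prodBernoulli w₂).real A * (prodBernoulli w₁).real B * (prodBernoulli w₃).real C - (prodBernoulli w₂).real A * (prodBernoulli w₁).real (B ∩ C) - (prodBernoulli w₂).real B * (prodBernoulli w₁).real (A ∩ C) - (prodBernoulli w₂).real C * (prodBernoulli w₁).real (A ∩ B)) +
        (2 * (prodBernoulli w₂).real (A ∩ B ∩ C) + (prodBernoulli w₂).real A * (prodBernoulli w₃).real B * (prodBernoulli w₁).real C - (prodBernoulli w₂).real A * (prodBernoulli w₃).real (B ∩ C) - (prodBernoulli w₂).real B * (prodBernoulli w₃).real (A ∩ C) - (prodBernoulli w₂).real C * (prodBernoulli w₃).real (A ∩ B)) +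
        (2 * (prodBernoulli w₃).real (A ∩ B ∩ C) + (prodBernoulli w₃).real A * (prodBernoulli w₁).real B * (prodBernoulli w₂).real C - (prodBernoulli w₃).real A * (prodBernoulli w₁).real (B ∩ C) - (prodBernoulli w₃).real B * (prodBernoulli w₁).real (A ∩ C) - (prodBernoulli w₃).real C * (prodBernoulli w₁).real (A ∩ B)) +
        (2 * (prodBernoulli w₃).real (A ∩ B ∩ C) + (prodBernoulli w₃).real A * (prodBernoulli w₂).real B * (prodBernoulli w₁).real C - (prodBernoulli w₃).real A * (prodBernoulli w₂).real (B ∩ C) - (prodBernoulli w₃).real B * (prodBernoulli w₂).real (A ∩ C) - (prodBernoulli w₃).real C * (prodBernoulli w₂).real (A ∩ B)))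
    (w : Sym2 (Fin n) → unitInterval) (a b c y : Fin n) :
    0 ≤ sahiE3 (prodBernoulli w) (connEvent (row 37 n (a, b, c, y)).1) (connEvent (row 37 n (a, b, c, y)).2.1)
      (connEvent (row 37 n (a, b, c, y)).2.2) := by
  have h := hMP w w w a b c y (fun _ => le_rfl) (fun _ => le_rfl) _ _ _ rfl rfl rfl
  have h6 := six_mul_sahiE3_eq_polar (prodBernoulli w) (connEvent (row 37 n (a, b, c, y)).1) (connEvent (row 37 n (a, b, c, y)).2.1)
    (connEvent (row 37 n (a, b, c, y)).2.2)
  linarith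

/-- **Row 44 `(D[ab|cy], D[a|b], D[c|y])` on every finite weighted graph from MONOTONE POLARIZATION for row 44** (hypothesis `hMP`, written out: the polarized
Sahi form of the row's three events is nonnegative at every pointwise-ordered triple of edge weights `w₃ ≤ w₂ ≤ w₁` on `Fin n`). [this work] -/
theorem frontier_44_all_of_monotonePolarization
    (hMP : ∀ (w₁ w₂ w₃ : Sym2 (Fin n) → unitInterval) (a b c y : Fin n), (∀ e, w₃ e ≤ w₂ e) → (∀ e, w₂ e ≤ w₁ e) →
      ∀ A B C : Set (BondConfig (Fin n)), A = connEvent (row 44 n (a, b, c, y)).1 → B = connEvent (row 44 n (a, b, c, y)).2.1 →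
      C = connEvent (row 44 n (a, b, c, y)).2.2 →
      0 ≤ (2 * (prodBernoulli w₁).real (A ∩ B ∩ C) + (prodBernoulli w₁).real A * (prodBernoulli w₂).real B * (prodBernoulli w₃).real C - (prodBernoulli w₁).real A * (prodBernoulli w₂).real (B ∩ C) - (prodBernoulli w₁).real B * (prodBernoulli w₂).real (A ∩ C) - (prodBernoulli w₁).real C * (prodBernoulli w₂).real (A ∩ B)) +
        (2 * (prodBernoulli w₁).real (A ∩ B ∩ C) + (prodBernoulli w₁).real A * (prodBernoulli w₃).real B * (prodBernoulli w₂).real C - (prodBernoulli w₁).real A * (prodBernoulli w₃).real (B ∩ C) - (prodBernoulli w₁).real B * (prodBernoulli w₃).real (A ∩ C) - (prodBernoulli w₁).real C * (prodBernoulli w₃).real (A ∩ B)) +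
        (2 * (prodBernoulli w₂).real (A ∩ B ∩ C) + (prodBernoulli w₂).real A * (prodBernoulli w₁).real B * (prodBernoulli w₃).real C - (prodBernoulli w₂).real A * (prodBernoulli w₁).real (B ∩ C) - (prodBernoulli w₂).real B * (prodBernoulli w₁).real (A ∩ C) - (prodBernoulli w₂).real C * (prodBernoulli w₁).real (A ∩ B)) +
        (2 * (prodBernoulli w₂).real (A ∩ B ∩ C) + (prodBernoulli w₂).real A * (prodBernoulli w₃).real B * (prodBernoulli w₁).real C - (prodBernoulli w₂).real A * (prodBernoulli w₃).real (B ∩ C) - (prodBernoulli w₂).real B * (prodBernoulli w₃).real (A ∩ C) - (prodBernoulli w₂).real C * (prodBernoulli w₃).real (A ∩ B)) +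
        (2 * (prodBernoulli w₃).real (A ∩ B ∩ C) + (prodBernoulli w₃).real A * (prodBernoulli w₁).real B * (prodBernoulli w₂).real C - (prodBernoulli w₃).real A * (prodBernoulli w₁).real (B ∩ C) - (prodBernoulli w₃).real B * (prodBernoulli w₁).real (A ∩ C) - (prodBernoulli w₃).real C * (prodBernoulli w₁).real (A ∩ B)) +
        (2 * (prodBernoulli w₃).real (A ∩ B ∩ C) + (prodBernoulli w₃).real A * (prodBernoulli w₂).real B * (prodBernoulli w₁).real C - (prodBernoulli w₃).real A * (prodBernoulli w₂).real (B ∩ C) - (prodBernoulli w₃).real B * (prodBernoulli w₂).real (A ∩ C) - (prodBernoulli w₃).real C * (prodBernoulli w₂).real (A ∩ B)))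
    (w : Sym2 (Fin n) → unitInterval) (a b c y : Fin n) :
    0 ≤ sahiE3 (prodBernoulli w) (connEvent (row 44 n (a, b, c, y)).1) (connEvent (row 44 n (a, b, c, y)).2.1)
      (connEvent (row 44 n (a, b, c, y)).2.2) := by
  have h := hMP w w w a b c y (fun _ => le_rfl) (fun _ => le_rfl) _ _ _ rfl rfl rfl
  have h6 := six_mul_sahiE3_eq_polar (prodBernoulli w) (connEvent (row 44 n (a, b, c, y)).1) (connEvent (row 44 n (a, b, c, y)).2.1)
    (connEvent (row 44 n (a, b, c, y)).2.2)
  linarith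

end Summit.CriticalPhenomena.PercolationContinuityZ3.Theorems.FrontierDecRows

end
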